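import Summits.AnomalousDissipation.AnomalousDissipation.Theorems.SolenoidalFractalHomogenisationLagrangianStepWindowLedger
import HarnessLib

/-!
# K1L_D (stmt-AnomalousDissipation-27980), S23‴: the LABEL-SPLIT WINDOW LEDGER `window_ledger_split` (v4 assembly backbone)
# (helper; `--supports … --as helper`)

The window ledger (`window_ledger`, p644546) with a SECOND per-window error: `u (k+1) = T k (u k) + e k + f k`, where `e k` is dissipation-dominated
against every test vector (as before) and `f k` — the evolved old high-label content of the label-split architecture (p4 g12 L4c §3 / lead F-lead-9 /
tenure D24-23) — is NOT, but is (i) small in energy, `‖f k‖² ≤ F k`, (ii) invisible to the coarse flow forward and backward, `‖T (k+1) (f k)‖ ≤ s k`,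
`‖(T k)† (f k)‖ ≤ s k`, (iii) weakly correlated with the fresh error, `|⟪e k, f k⟫| ≤ c k`, with budgets `Σ_{k<K} (F k + 2 c k) ≤ η′·Σ_{k<K} 𝔇_k(u k)` and
`Σ s k` (super-)small, and the true chain is norm-bounded by its start (`‖u k‖ ≤ ‖u 0‖`, a contraction chain).  CONCLUSION:
`‖u K‖² ≤ ‖v K‖² + 4(η + η′)·(‖v 0‖² − ‖v K‖²) + 10·(Σ_{k<K} s k)·‖v 0‖`, uniformly in `K`.  Pure Hilbert-space algebra.  Infrastructure for rung F-D1.A0;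
NOT a proof of the crux or of anomalous dissipation.
-/

set_option linter.dupNamespace false

namespace Summit.AnomalousDissipation.AnomalousDissipation.Theorems.SolenoidalFractalHomogenisation.LagrangianStep

open scoped InnerProductSpace
open ContinuousLinearMap

noncomputable section

variable {V : Type*} [NormedAddCommGroup V] [InnerProductSpace ℝ V] [CompleteSpace V]

/-! ## One window with the extra error `f` -/

/-- The extra error's work on a coarse-propagated vector: `|⟪T w, f⟫| ≤ ‖w‖·‖T† f‖`. -/
theorem abs_inner_apply_le_norm_mul_adjoint (T : V →L[ℝ] V) (w f : V) : |⟪T w, f⟫_ℝ| ≤ ‖w‖ * ‖adjoint T f‖ := by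
  rw [← adjoint_inner_right]
  exact abs_real_inner_le_norm _ _

/-- ONE-WINDOW ENERGY BALANCE with the extra error:
`(1 − 2η − η²)·𝔇 ≤ ‖u‖² − ‖T u + e + f‖² + 2‖u‖·‖T† f‖ + 2|⟪e,f⟫| + ‖f‖²`. -/
theorem dissip_le_energy_drop_split {T : V →L[ℝ] V} (hT : ∀ x, ‖T x‖ ≤ ‖x‖) {u e : V} (f : V) {η : ℝ} (hη : 0 ≤ η)
    (hDD : ∀ y : V, |⟪y, e⟫_ℝ| ≤ η * Real.sqrt (‖u‖ ^ 2 - ‖T u‖ ^ 2) * Real.sqrt (‖y‖ ^ 2 - ‖adjoint T y‖ ^ 2)) :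
    (1 - 2 * η - η ^ 2) * (‖u‖ ^ 2 - ‖T u‖ ^ 2) ≤
      ‖u‖ ^ 2 - ‖T u + e + f‖ ^ 2 + 2 * (‖u‖ * ‖adjoint T f‖) + 2 * |⟪e, f⟫_ℝ| + ‖f‖ ^ 2 := by
  have h0 := dissip_le_energy_drop hT hη hDD
  have h1 : ‖T u + e + f‖ ^ 2 = ‖T u + e‖ ^ 2 + 2 * ⟪T u + e, f⟫_ℝ + ‖f‖ ^ 2 := norm_add_sq_real _ _
  have h2 : ⟪T u + e, f⟫_ℝ = ⟪T u, f⟫_ℝ + ⟪e, f⟫_ℝ := inner_add_left _ _ _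
  have h3 : ⟪T u, f⟫_ℝ ≤ ‖u‖ * ‖adjoint T f‖ := (le_abs_self _).trans (abs_inner_apply_le_norm_mul_adjoint T u f)
  have h4 : ⟪e, f⟫_ℝ ≤ |⟪e, f⟫_ℝ| := le_abs_self _
  nlinarith

/-- ONE-WINDOW DISCREPANCY BALANCE with the extra error:
`‖T d + e + f‖² ≤ ‖d‖² + 2η²·𝔇 + 2‖d‖·‖T† f‖ + 2|⟪e,f⟫| + ‖f‖²`. -/
theorem norm_sq_apply_add_err_le_split {T : V →L[ℝ] V} (hT : ∀ x, ‖T x‖ ≤ ‖x‖) {u e : V} (d f : V) {η : ℝ} (hη : 0 ≤ η)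
    (hDD : ∀ y : V, |⟪y, e⟫_ℝ| ≤ η * Real.sqrt (‖u‖ ^ 2 - ‖T u‖ ^ 2) * Real.sqrt (‖y‖ ^ 2 - ‖adjoint T y‖ ^ 2)) :
    ‖T d + e + f‖ ^ 2 ≤ ‖d‖ ^ 2 + 2 * η ^ 2 * (‖u‖ ^ 2 - ‖T u‖ ^ 2) + 2 * (‖d‖ * ‖adjoint T f‖) + 2 * |⟪e, f⟫_ℝ| + ‖f‖ ^ 2 := by
  have h0 := norm_sq_apply_add_err_le hT d hη hDD
  have h1 : ‖T d + e + f‖ ^ 2 = ‖T d + e‖ ^ 2 + 2 * ⟪T d + e, f⟫_ℝ + ‖f‖ ^ 2 := norm_add_sq_real _ _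
  have h2 : ⟪T d + e, f⟫_ℝ = ⟪T d, f⟫_ℝ + ⟪e, f⟫_ℝ := inner_add_left _ _ _
  have h3 : ⟪T d, f⟫_ℝ ≤ ‖d‖ * ‖adjoint T f‖ := (le_abs_self _).trans (abs_inner_apply_le_norm_mul_adjoint T d f)
  have h4 : ⟪e, f⟫_ℝ ≤ |⟪e, f⟫_ℝ| := le_abs_self _
  nlinarith

/-! ## The sums -/

/-- **ENERGY SUM with the extra error** (true chain norm-bounded by its start):
`(1 − 2η − η²)·Σ𝔇 ≤ ‖u 0‖² − ‖u K‖² + Σ_{k<K} (2‖u 0‖·‖(T k)† (f k)‖ + 2|⟪e k, f k⟫| + ‖f k‖²)`. -/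
theorem dissip_sum_le_split (T : ℕ → V →L[ℝ] V) (hT : ∀ k x, ‖T k x‖ ≤ ‖x‖) (u e f : ℕ → V) (η : ℝ) (hη : 0 ≤ η)
    (hu : ∀ k, u (k + 1) = T k (u k) + e k + f k) (huB : ∀ k, ‖u k‖ ≤ ‖u 0‖)
    (hDD : ∀ k, ∀ y : V, |⟪y, e k⟫_ℝ| ≤
      η * Real.sqrt (‖u k‖ ^ 2 - ‖T k (u k)‖ ^ 2) * Real.sqrt (‖y‖ ^ 2 - ‖adjoint (T k) y‖ ^ 2))
    (K : ℕ) :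
    (1 - 2 * η - η ^ 2) * ∑ k ∈ Finset.range K, (‖u k‖ ^ 2 - ‖T k (u k)‖ ^ 2) ≤
      ‖u 0‖ ^ 2 - ‖u K‖ ^ 2 +
        ∑ k ∈ Finset.range K, (2 * (‖u 0‖ * ‖adjoint (T k) (f k)‖) + 2 * |⟪e k, f k⟫_ℝ| + ‖f k‖ ^ 2) := by
  induction K with
  | zero => simp
  | succ K ih =>
    rw [Finset.sum_range_succ, Finset.sum_range_succ, mul_add]
    have hstep := dissip_le_energy_drop_split (hT K) (f K) hη (hDD K)
    rw [← hu K] at hstep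
    have hmono : ‖u K‖ * ‖adjoint (T K) (f K)‖ ≤ ‖u 0‖ * ‖adjoint (T K) (f K)‖ :=
      mul_le_mul_of_nonneg_right (huB K) (norm_nonneg _)
    linarith

/-- **DISCREPANCY SUM with the extra error**:
`‖u K − v K‖² ≤ 2η²·Σ𝔇 + Σ_{k<K} (4‖u 0‖·‖(T k)† (f k)‖ + 2|⟪e k, f k⟫| + ‖f k‖²)`. -/
theorem norm_sq_sub_le_split (T : ℕ → V →L[ℝ] V) (hT : ∀ k x, ‖T k x‖ ≤ ‖x‖) (u v e f : ℕ → V) (η : ℝ) (hη : 0 ≤ η)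
    (h0 : u 0 = v 0) (hv : ∀ k, v (k + 1) = T k (v k)) (hu : ∀ k, u (k + 1) = T k (u k) + e k + f k)
    (huB : ∀ k, ‖u k‖ ≤ ‖u 0‖)
    (hDD : ∀ k, ∀ y : V, |⟪y, e k⟫_ℝ| ≤
      η * Real.sqrt (‖u k‖ ^ 2 - ‖T k (u k)‖ ^ 2) * Real.sqrt (‖y‖ ^ 2 - ‖adjoint (T k) y‖ ^ 2))
    (K : ℕ) :
    ‖u K - v K‖ ^ 2 ≤ 2 * η ^ 2 * ∑ k ∈ Finset.range K, (‖u k‖ ^ 2 - ‖T k (u k)‖ ^ 2) +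
      ∑ k ∈ Finset.range K, (4 * (‖u 0‖ * ‖adjoint (T k) (f k)‖) + 2 * |⟪e k, f k⟫_ℝ| + ‖f k‖ ^ 2) := by
  induction K with
  | zero => simp [h0]
  | succ K ih =>
    rw [Finset.sum_range_succ, Finset.sum_range_succ, mul_add]
    have hrec : u (K + 1) - v (K + 1) = T K (u K - v K) + e K + f K := by
      rw [hu K, hv K, map_sub]; abel
    rw [hrec]
    have hstep := norm_sq_apply_add_err_le_split (hT K) (u K - v K) (f K) hη (hDD K)
    -- `‖u K − v K‖ ≤ 2‖u 0‖`
    have hvK : ‖v K‖ ≤ ‖v 0‖ := norm_exact_le T hT v hv K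
    have hdK : ‖u K - v K‖ ≤ 2 * ‖u 0‖ := by
      calc ‖u K - v K‖ ≤ ‖u K‖ + ‖v K‖ := norm_sub_le _ _
        _ ≤ ‖u 0‖ + ‖v 0‖ := add_le_add (huB K) hvK
        _ = 2 * ‖u 0‖ := by rw [h0]; ring
    have hmono : ‖u K - v K‖ * ‖adjoint (T K) (f K)‖ ≤ 2 * ‖u 0‖ * ‖adjoint (T K) (f K)‖ :=
      mul_le_mul_of_nonneg_right hdK (norm_nonneg _)
    nlinarith [norm_nonneg (adjoint (T K) (f K)), norm_nonneg (u 0)]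

/-- **DUALITY SUM with the extra error (inductive form).**  As `duality_sum`, plus the pairings of the chain with the extra errors: those at least one
window below the top convert through `T (k+1) (f k)` (coarse-invisible forward), the top one stays explicit:
`|⟪z, u K − v K⟫| ≤ η √Σ𝔇 √(‖z‖² − ‖b‖²) + ‖z‖·Σ_{k+1<K} ‖T (k+1) (f k)‖ + |⟪z, f (K−1)⟫|` (last term absent for `K = 0`). -/
theorem duality_sum_split (T : ℕ → V →L[ℝ] V) (hT : ∀ k x, ‖T k x‖ ≤ ‖x‖) (u v e f : ℕ → V) (η : ℝ) (hη : 0 ≤ η)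
    (h0 : u 0 = v 0) (hv : ∀ k, v (k + 1) = T k (v k)) (hu : ∀ k, u (k + 1) = T k (u k) + e k + f k)
    (hDD : ∀ k, ∀ y : V, |⟪y, e k⟫_ℝ| ≤
      η * Real.sqrt (‖u k‖ ^ 2 - ‖T k (u k)‖ ^ 2) * Real.sqrt (‖y‖ ^ 2 - ‖adjoint (T k) y‖ ^ 2))
    (K : ℕ) (z : V) :
    ∃ b : V, ‖b‖ ≤ ‖z‖ ∧ ⟪b, v 0⟫_ℝ = ⟪z, v K⟫_ℝ ∧
      |⟪z, u K - v K⟫_ℝ| ≤ η * Real.sqrt (∑ k ∈ Finset.range K, (‖u k‖ ^ 2 - ‖T k (u k)‖ ^ 2)) *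
        Real.sqrt (‖z‖ ^ 2 - ‖b‖ ^ 2) + ‖z‖ * ∑ k ∈ Finset.range (K - 1), ‖T (k + 1) (f k)‖ +
        (if K = 0 then 0 else |⟪z, f (K - 1)⟫_ℝ|) := by
  induction K generalizing z with
  | zero =>
    refine ⟨z, le_rfl, rfl, ?_⟩
    simp [h0]
  | succ K ih =>
    obtain ⟨b, hb, hdual, hbound⟩ := ih (adjoint (T K) z)
    have hTz : ‖adjoint (T K) z‖ ≤ ‖z‖ := norm_adjoint_apply_le_of_contraction (hT K) z
    refine ⟨b, hb.trans hTz, ?_, ?_⟩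
    · rw [hdual, adjoint_inner_left, ← hv K]
    · have hsplit : ⟪z, u (K + 1) - v (K + 1)⟫_ℝ =
          ⟪adjoint (T K) z, u K - v K⟫_ℝ + ⟪z, e K⟫_ℝ + ⟪z, f K⟫_ℝ := by
        rw [hu K, hv K, adjoint_inner_left, map_sub]
        rw [show T K (u K) + e K + f K - T K (v K) = (T K (u K) - T K (v K)) + e K + f K by abel,
          inner_add_right, inner_add_right]
      set S : ℝ := ∑ k ∈ Finset.range K, (‖u k‖ ^ 2 - ‖T k (u k)‖ ^ 2) with hS_def
      set D : ℝ := ‖u K‖ ^ 2 - ‖T K (u K)‖ ^ 2 with hD_def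
      set a : ℝ := ‖adjoint (T K) z‖ ^ 2 - ‖b‖ ^ 2 with ha_def
      set c : ℝ := ‖z‖ ^ 2 - ‖adjoint (T K) z‖ ^ 2 with hc_def
      have hS : 0 ≤ S := Finset.sum_nonneg fun k _ => dissip_nonneg (hT k) (u k)
      have hD : 0 ≤ D := dissip_nonneg (hT K) (u K)
      have ha : 0 ≤ a := by rw [ha_def]; nlinarith [norm_nonneg b, norm_nonneg (adjoint (T K) z)]
      have hc : 0 ≤ c := dissipAdj_nonneg (hT K) z
      have hsum : ∑ k ∈ Finset.range (K + 1), (‖u k‖ ^ 2 - ‖T k (u k)‖ ^ 2) = S + D := by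
        rw [Finset.sum_range_succ]
      have hac : ‖z‖ ^ 2 - ‖b‖ ^ 2 = a + c := by rw [ha_def, hc_def]; ring
      -- the (DD) part, exactly as in `duality_sum`
      have hmain : |⟪adjoint (T K) z, u K - v K⟫_ℝ| - (‖adjoint (T K) z‖ * ∑ k ∈ Finset.range (K - 1), ‖T (k + 1) (f k)‖ +
            (if K = 0 then 0 else |⟪adjoint (T K) z, f (K - 1)⟫_ℝ|)) + |⟪z, e K⟫_ℝ|
          ≤ η * Real.sqrt (S + D) * Real.sqrt (a + c) := by
        calc _ ≤ η * Real.sqrt S * Real.sqrt a + η * Real.sqrt D * Real.sqrt c := by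
              have := hDD K z; linarith
          _ = η * (Real.sqrt S * Real.sqrt a + Real.sqrt D * Real.sqrt c) := by ring
          _ ≤ η * (Real.sqrt (S + D) * Real.sqrt (a + c)) :=
            mul_le_mul_of_nonneg_left (sqrt_mul_sqrt_add_le_sqrt_add_mul hS ha hD hc) hη
          _ = η * Real.sqrt (S + D) * Real.sqrt (a + c) := by ring
      -- the inherited f-terms, re-expressed at the new top `z`
      have hconv : ‖adjoint (T K) z‖ * ∑ k ∈ Finset.range (K - 1), ‖T (k + 1) (f k)‖ +
            (if K = 0 then 0 else |⟪adjoint (T K) z, f (K - 1)⟫_ℝ|)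
          ≤ ‖z‖ * ∑ k ∈ Finset.range (K + 1 - 1), ‖T (k + 1) (f k)‖ := by
        have hs0 : ∀ k, 0 ≤ ‖T (k + 1) (f k)‖ := fun k => norm_nonneg _
        rcases Nat.eq_zero_or_pos K with hK0 | hKpos
        · subst hK0; simp
        · have hK : K = (K - 1) + 1 := by omega
          rw [if_neg (by omega), show K + 1 - 1 = (K - 1) + 1 by omega, Finset.sum_range_succ, mul_add]
          have h1 : ‖adjoint (T K) z‖ * ∑ k ∈ Finset.range (K - 1), ‖T (k + 1) (f k)‖
              ≤ ‖z‖ * ∑ k ∈ Finset.range (K - 1), ‖T (k + 1) (f k)‖ :=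
            mul_le_mul_of_nonneg_right hTz (Finset.sum_nonneg fun k _ => hs0 k)
          have h2 : |⟪adjoint (T K) z, f (K - 1)⟫_ℝ| ≤ ‖z‖ * ‖T (K - 1 + 1) (f (K - 1))‖ := by
            rw [adjoint_inner_left, show K - 1 + 1 = K by omega]
            exact abs_real_inner_le_norm _ _
          linarith
      rw [hsplit, hsum, hac, if_neg (Nat.succ_ne_zero K), show K + 1 - 1 = K by omega]
      rw [show K + 1 - 1 = K by omega] at hconv
      calc |⟪adjoint (T K) z, u K - v K⟫_ℝ + ⟪z, e K⟫_ℝ + ⟪z, f K⟫_ℝ|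
          ≤ |⟪adjoint (T K) z, u K - v K⟫_ℝ| + |⟪z, e K⟫_ℝ| + |⟪z, f K⟫_ℝ| := by
            have h1 := abs_add_le (⟪adjoint (T K) z, u K - v K⟫_ℝ + ⟪z, e K⟫_ℝ) ⟪z, f K⟫_ℝ
            have h2 := abs_add_le ⟪adjoint (T K) z, u K - v K⟫_ℝ ⟪z, e K⟫_ℝ
            linarith
        _ ≤ η * Real.sqrt (S + D) * Real.sqrt (a + c) + ‖z‖ * ∑ k ∈ Finset.range K, ‖T (k + 1) (f k)‖ + |⟪z, f K⟫_ℝ| := by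
            linarith

set_option maxHeartbeats 400000 in
/-- **THE LABEL-SPLIT WINDOW LEDGER.**  `T k` linear contractions of a real Hilbert space; `v (k+1) = T k (v k)` the exact (coarse) chain;
`u (k+1) = T k (u k) + e k + f k` the true chain from the same start, norm-bounded by its start; `e k` dissipation-dominated against every test
vector (`0 ≤ η ≤ 1/8`); `f k` with energy `‖f k‖² ≤ F k`, coarse-invisible (`‖T (k+1) (f k)‖ ≤ s k`, `‖(T k)† (f k)‖ ≤ s k`), overlap
`|⟪e k, f k⟫| ≤ c k`, and budgets `Σ_{k<K}(F k + 2 c k) ≤ η′·Σ_{k<K} 𝔇_k(u k)` (`0 ≤ η′ ≤ 1/8`).  Then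
`‖u K‖² ≤ ‖v K‖² + 4(η + η′)·(‖v 0‖² − ‖v K‖²) + 10·(Σ_{k<K} s k)·‖v 0‖`. -/
theorem window_ledger_split (T : ℕ → V →L[ℝ] V) (hT : ∀ k x, ‖T k x‖ ≤ ‖x‖) (u v e f : ℕ → V) (η η' : ℝ) (F c s : ℕ → ℝ)
    (hη : 0 ≤ η) (hη8 : η ≤ 1 / 8) (hη' : 0 ≤ η') (hη'8 : η' ≤ 1 / 8) (hs : ∀ k, 0 ≤ s k)
    (h0 : u 0 = v 0) (hv : ∀ k, v (k + 1) = T k (v k)) (hu : ∀ k, u (k + 1) = T k (u k) + e k + f k)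
    (huB : ∀ k, ‖u k‖ ≤ ‖u 0‖)
    (hDD : ∀ k, ∀ y : V, |⟪y, e k⟫_ℝ| ≤
      η * Real.sqrt (‖u k‖ ^ 2 - ‖T k (u k)‖ ^ 2) * Real.sqrt (‖y‖ ^ 2 - ‖adjoint (T k) y‖ ^ 2))
    (hF1 : ∀ k, ‖f k‖ ^ 2 ≤ F k) (hF2 : ∀ k, ‖T (k + 1) (f k)‖ ≤ s k) (hF3 : ∀ k, ‖adjoint (T k) (f k)‖ ≤ s k)
    (hF4 : ∀ k, |⟪e k, f k⟫_ℝ| ≤ c k)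
    (hbudget : ∀ K, ∑ k ∈ Finset.range K, (F k + 2 * c k) ≤ η' * ∑ k ∈ Finset.range K, (‖u k‖ ^ 2 - ‖T k (u k)‖ ^ 2))
    (K : ℕ) :
    ‖u K‖ ^ 2 ≤ ‖v K‖ ^ 2 + 4 * (η + η') * (‖v 0‖ ^ 2 - ‖v K‖ ^ 2) + 10 * (∑ k ∈ Finset.range K, s k) * ‖v 0‖ := by
  set S : ℝ := ∑ k ∈ Finset.range K, (‖u k‖ ^ 2 - ‖T k (u k)‖ ^ 2) with hS_def
  set Ss : ℝ := ∑ k ∈ Finset.range K, s k with hSs_def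
  have hS : 0 ≤ S := Finset.sum_nonneg fun k _ => dissip_nonneg (hT k) (u k)
  have hSs : 0 ≤ Ss := Finset.sum_nonneg fun k _ => hs k
  have hv0 : 0 ≤ ‖v 0‖ := norm_nonneg _
  have hu0 : ‖u 0‖ = ‖v 0‖ := by rw [h0]
  have hvK : ‖v K‖ ≤ ‖v 0‖ := norm_exact_le T hT v hv K
  have hdropv : 0 ≤ ‖v 0‖ ^ 2 - ‖v K‖ ^ 2 := sub_nonneg.mpr (pow_le_pow_left₀ (norm_nonneg _) hvK 2)
  -- the f-sums against the budgets
  have hbud : ∑ k ∈ Finset.range K, (F k + 2 * c k) ≤ η' * S := hbudget K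
  have hsplit2 : ∑ k ∈ Finset.range K, (2 * ‖u 0‖ * s k + (F k + 2 * c k)) = 2 * ‖u 0‖ * Ss + ∑ k ∈ Finset.range K, (F k + 2 * c k) := by
    rw [Finset.sum_add_distrib, ← Finset.mul_sum]
  have hsplit4 : ∑ k ∈ Finset.range K, (4 * ‖u 0‖ * s k + (F k + 2 * c k)) = 4 * ‖u 0‖ * Ss + ∑ k ∈ Finset.range K, (F k + 2 * c k) := by
    rw [Finset.sum_add_distrib, ← Finset.mul_sum]
  have hfsum1 : ∑ k ∈ Finset.range K, (2 * (‖u 0‖ * ‖adjoint (T k) (f k)‖) + 2 * |⟪e k, f k⟫_ℝ| + ‖f k‖ ^ 2)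
      ≤ 2 * ‖v 0‖ * Ss + η' * S := by
    have h1 : ∑ k ∈ Finset.range K, (2 * (‖u 0‖ * ‖adjoint (T k) (f k)‖) + 2 * |⟪e k, f k⟫_ℝ| + ‖f k‖ ^ 2)
        ≤ ∑ k ∈ Finset.range K, (2 * ‖u 0‖ * s k + (F k + 2 * c k)) :=
      Finset.sum_le_sum fun k _ => by
        have a1 : ‖u 0‖ * ‖adjoint (T k) (f k)‖ ≤ ‖u 0‖ * s k := mul_le_mul_of_nonneg_left (hF3 k) (norm_nonneg _)
        linarith [hF1 k, hF4 k]
    rw [hsplit2] at h1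
    have hc : 2 * ‖u 0‖ * Ss = 2 * ‖v 0‖ * Ss := by rw [hu0]
    linarith
  have hfsum2 : ∑ k ∈ Finset.range K, (4 * (‖u 0‖ * ‖adjoint (T k) (f k)‖) + 2 * |⟪e k, f k⟫_ℝ| + ‖f k‖ ^ 2)
      ≤ 4 * ‖v 0‖ * Ss + η' * S := by
    have h1 : ∑ k ∈ Finset.range K, (4 * (‖u 0‖ * ‖adjoint (T k) (f k)‖) + 2 * |⟪e k, f k⟫_ℝ| + ‖f k‖ ^ 2)
        ≤ ∑ k ∈ Finset.range K, (4 * ‖u 0‖ * s k + (F k + 2 * c k)) :=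
      Finset.sum_le_sum fun k _ => by
        have a1 : ‖u 0‖ * ‖adjoint (T k) (f k)‖ ≤ ‖u 0‖ * s k := mul_le_mul_of_nonneg_left (hF3 k) (norm_nonneg _)
        linarith [hF1 k, hF4 k]
    rw [hsplit4] at h1
    have hc : 4 * ‖u 0‖ * Ss = 4 * ‖v 0‖ * Ss := by rw [hu0]
    linarith
  -- energy and discrepancy sums
  have hSu := dissip_sum_le_split T hT u e f η hη hu huB hDD K
  have hd := norm_sq_sub_le_split T hT u v e f η hη h0 hv hu huB hDD K
  -- duality at `z = v K`
  obtain ⟨b, hb, hdual, hbound⟩ := duality_sum_split T hT u v e f η hη h0 hv hu hDD K (v K)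
  have hvv : ⟪b, v 0⟫_ℝ = ‖v K‖ ^ 2 := by rw [hdual, real_inner_self_eq_norm_sq]
  have hkey : ‖v K‖ ^ 2 - ‖b‖ ^ 2 ≤ ‖v 0‖ ^ 2 - ‖v K‖ ^ 2 := by
    have h1 : ‖v K‖ ^ 2 ≤ ‖b‖ * ‖v 0‖ := by rw [← hvv]; exact real_inner_le_norm _ _
    by_cases h00 : ‖v 0‖ = 0
    · have : ‖v K‖ = 0 := le_antisymm (by rw [← h00]; exact hvK) (norm_nonneg _)
      rw [this, h00]; nlinarith [norm_nonneg b]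
    · have hpos : 0 < ‖v 0‖ ^ 2 := by positivity
      have h3 : (‖v K‖ ^ 2 - ‖b‖ ^ 2) * ‖v 0‖ ^ 2 ≤ (‖v 0‖ ^ 2 - ‖v K‖ ^ 2) * ‖v 0‖ ^ 2 := by
        nlinarith [norm_nonneg (v K), sq_nonneg (‖v 0‖ ^ 2 - ‖v K‖ ^ 2), norm_nonneg b]
      exact le_of_mul_le_mul_right h3 hpos
  -- the f-pairings in the duality sum: `‖v K‖ Σ_{k+1<K} ‖T (k+1) (f k)‖ + |⟪v K, f (K−1)⟫| ≤ 2 ‖v 0‖ Σs`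
  have hfdual : ‖v K‖ * ∑ k ∈ Finset.range (K - 1), ‖T (k + 1) (f k)‖ + (if K = 0 then 0 else |⟪v K, f (K - 1)⟫_ℝ|)
      ≤ 2 * ‖v 0‖ * Ss := by
    have hpart : ∑ k ∈ Finset.range (K - 1), ‖T (k + 1) (f k)‖ ≤ Ss := by
      calc ∑ k ∈ Finset.range (K - 1), ‖T (k + 1) (f k)‖ ≤ ∑ k ∈ Finset.range (K - 1), s k :=
            Finset.sum_le_sum fun k _ => hF2 k
        _ ≤ Ss := by
            rw [hSs_def]
            exact Finset.sum_le_sum_of_subset_of_nonneg (Finset.range_mono (Nat.sub_le K 1)) fun k _ _ => hs k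
    have h1 : ‖v K‖ * ∑ k ∈ Finset.range (K - 1), ‖T (k + 1) (f k)‖ ≤ ‖v 0‖ * Ss :=
      mul_le_mul hvK hpart (Finset.sum_nonneg fun k _ => norm_nonneg _) hv0
    have h2 : (if K = 0 then 0 else |⟪v K, f (K - 1)⟫_ℝ|) ≤ ‖v 0‖ * Ss := by
      rcases Nat.eq_zero_or_pos K with hK0 | hKpos
      · subst hK0; simp only [if_true]; positivity
      · rw [if_neg (by omega)]
        have hK : K = (K - 1) + 1 := by omega
        have hvK' : v K = T (K - 1) (v (K - 1)) := by
          conv_lhs => rw [hK]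
          exact hv (K - 1)
        calc |⟪v K, f (K - 1)⟫_ℝ| = |⟪T (K - 1) (v (K - 1)), f (K - 1)⟫_ℝ| := by rw [hvK']
          _ ≤ ‖v (K - 1)‖ * ‖adjoint (T (K - 1)) (f (K - 1))‖ := abs_inner_apply_le_norm_mul_adjoint _ _ _
          _ ≤ ‖v 0‖ * s (K - 1) := mul_le_mul (norm_exact_le T hT v hv (K - 1)) (hF3 _) (norm_nonneg _) hv0
          _ ≤ ‖v 0‖ * Ss := by
              refine mul_le_mul_of_nonneg_left ?_ hv0
              rw [hSs_def]
              exact Finset.single_le_sum (fun k _ => hs k) (Finset.mem_range.mpr (by omega))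
    linarith
  have hcross : ⟪v K, u K - v K⟫_ℝ ≤ η * Real.sqrt S * Real.sqrt (‖v 0‖ ^ 2 - ‖v K‖ ^ 2) + 2 * ‖v 0‖ * Ss := by
    have hA : 0 ≤ η * Real.sqrt S := mul_nonneg hη (Real.sqrt_nonneg _)
    have h1 : η * Real.sqrt S * Real.sqrt (‖v K‖ ^ 2 - ‖b‖ ^ 2) ≤ η * Real.sqrt S * Real.sqrt (‖v 0‖ ^ 2 - ‖v K‖ ^ 2) :=
      mul_le_mul_of_nonneg_left (Real.sqrt_le_sqrt hkey) hA
    linarith [le_abs_self ⟪v K, u K - v K⟫_ℝ]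
  -- AM–GM on the cross term
  have hamgm : 2 * (η * Real.sqrt S * Real.sqrt (‖v 0‖ ^ 2 - ‖v K‖ ^ 2)) ≤ η * (S + (‖v 0‖ ^ 2 - ‖v K‖ ^ 2)) := by
    have h := two_mul_le_add_sq (Real.sqrt S) (Real.sqrt (‖v 0‖ ^ 2 - ‖v K‖ ^ 2))
    rw [Real.sq_sqrt hS, Real.sq_sqrt hdropv] at h
    have := mul_le_mul_of_nonneg_left h hη
    linarith
  have hcross' : 2 * ⟪v K, u K - v K⟫_ℝ ≤ η * (S + (‖v 0‖ ^ 2 - ‖v K‖ ^ 2)) + 4 * ‖v 0‖ * Ss := by linarith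
  have hexp : ‖u K‖ ^ 2 = ‖v K‖ ^ 2 + 2 * ⟪v K, u K - v K⟫_ℝ + ‖u K - v K‖ ^ 2 := by
    rw [← norm_add_sq_real, add_sub_cancel]
  -- collect: `‖u K‖² ≤ ‖v K‖² + η·drop_v + (η + 2η² + η′)·S + 8 ‖v 0‖ Σs`
  have hcollect : ‖u K‖ ^ 2 ≤ ‖v K‖ ^ 2 + η * (‖v 0‖ ^ 2 - ‖v K‖ ^ 2) + (η + 2 * η ^ 2 + η') * S + 8 * ‖v 0‖ * Ss := by
    linarith
  have hpos1 : 0 ≤ 4 * (η + η') * (‖v 0‖ ^ 2 - ‖v K‖ ^ 2) := by positivity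
  have hpos2 : 0 ≤ 10 * Ss * ‖v 0‖ := by positivity
  have hηη : η * η ≤ η * (1 / 8) := mul_le_mul_of_nonneg_left hη8 hη
  have hsqη : η ^ 2 = η * η := sq η
  have hcoefS : (η + 2 * η ^ 2 + η') * S ≤ (5 / 4 * η + η') * S := by
    refine mul_le_mul_of_nonneg_right ?_ hS
    rw [hsqη]; linarith
  by_cases hcase : ‖u K‖ ^ 2 ≤ ‖v K‖ ^ 2
  · linarith
  · -- `drop_u ≤ drop_v`, hence `(39/64) S ≤ drop_v + 2 ‖v 0‖ Σs`
    have hdropu : ‖u 0‖ ^ 2 - ‖u K‖ ^ 2 ≤ ‖v 0‖ ^ 2 - ‖v K‖ ^ 2 := by rw [h0]; linarith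
    have hκ : (47 : ℝ) / 64 ≤ 1 - 2 * η - η ^ 2 := by
      have : η * η ≤ 1 / 8 * (1 / 8) := mul_le_mul hη8 hη8 hη (by norm_num)
      rw [hsqη]; linarith
    have hκS : (47 : ℝ) / 64 * S ≤ (1 - 2 * η - η ^ 2) * S := mul_le_mul_of_nonneg_right hκ hS
    have hη'S : η' * S ≤ 1 / 8 * S := mul_le_mul_of_nonneg_right hη'8 hS
    have hS' : (39 : ℝ) / 64 * S ≤ (‖v 0‖ ^ 2 - ‖v K‖ ^ 2) + 2 * ‖v 0‖ * Ss := by linarith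
    have hSb : S ≤ 64 / 39 * ((‖v 0‖ ^ 2 - ‖v K‖ ^ 2) + 2 * ‖v 0‖ * Ss) := by linarith
    have hc0 : 0 ≤ 5 / 4 * η + η' := by positivity
    have hmain : (5 / 4 * η + η') * S ≤ (5 / 4 * η + η') * (64 / 39 * ((‖v 0‖ ^ 2 - ‖v K‖ ^ 2) + 2 * ‖v 0‖ * Ss)) :=
      mul_le_mul_of_nonneg_left hSb hc0
    -- numerical coefficients: `(5/4η+η′)(64/39) ≤ 3(η+η′)` and `η+η′ ≤ 1/4`
    have hA : (5 / 4 * η + η') * (64 / 39 * (‖v 0‖ ^ 2 - ‖v K‖ ^ 2)) ≤ 3 * (η + η') * (‖v 0‖ ^ 2 - ‖v K‖ ^ 2) := by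
      have h1 : (5 / 4 * η + η') * (64 / 39) ≤ 3 * (η + η') := by linarith
      have h2 := mul_le_mul_of_nonneg_right h1 hdropv
      linarith
    have hB : (5 / 4 * η + η') * (64 / 39 * (2 * ‖v 0‖ * Ss)) ≤ 2 * Ss * ‖v 0‖ := by
      have h1 : (5 / 4 * η + η') * (64 / 39) * 2 ≤ 2 := by linarith
      have h2 : 0 ≤ ‖v 0‖ * Ss := mul_nonneg hv0 hSs
      have h3 := mul_le_mul_of_nonneg_right h1 h2
      linarith
    have hsum : (5 / 4 * η + η') * S ≤ 3 * (η + η') * (‖v 0‖ ^ 2 - ‖v K‖ ^ 2) + 2 * Ss * ‖v 0‖ := by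
      have : (5 / 4 * η + η') * (64 / 39 * ((‖v 0‖ ^ 2 - ‖v K‖ ^ 2) + 2 * ‖v 0‖ * Ss))
          = (5 / 4 * η + η') * (64 / 39 * (‖v 0‖ ^ 2 - ‖v K‖ ^ 2)) + (5 / 4 * η + η') * (64 / 39 * (2 * ‖v 0‖ * Ss)) := by ring
      linarith
    have hηdrop : η * (‖v 0‖ ^ 2 - ‖v K‖ ^ 2) ≤ (η + η') * (‖v 0‖ ^ 2 - ‖v K‖ ^ 2) :=
      mul_le_mul_of_nonneg_right (by linarith) hdropv
    linarith

end

end Summit.AnomalousDissipation.AnomalousDissipation.Theorems.SolenoidalFractalHomogenisation.LagrangianStep
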